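import Literature.AnabelianGeometry.AbsoluteAnabelian.MLFClosureUnitsInfinitelyDivisible
import Literature.NumberTheory.GaloisRepresentations.LocalReciprocityThetaProofs
import Literature.NumberTheory.GaloisRepresentations.LocalFieldProofs
import Mathlib.FieldTheory.Galois.Infinite
import Mathlib.RingTheory.RootsOfUnity.AlgebraicallyClosed
import HarnessLib

/-!
# [AbsTopIII] Proposition 3.2 (iv), injectivity half — DISCHARGED

Proof-only companion (theorems only, no definitions) of `MonoidKummerMaps.lean` (abc-iut-L4-t2;
S. Mochizuki, *Topics in absolute anabelian geometry III*, Prop. 3.2 (iv) p. 72, bib key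
`MochizukiAbsTopIII2015`, lit key `paper:url-5493eb38cbb7`): the named fact
`PairIsoDeterminedByGalois` — "the natural functor of Definition 3.1, (iii), induces an injection
`Isom((Π ↷ M_T), (Π* ↷ M*_T)) ↪ Isom_TG(Π, Π*)`", `T = TM` — is PROVED (`pairIsoDeterminedByGalois_holds`),
unconditionally and without class field theory.  Two isomorphisms with the same Galois component
differ by an automorphism over `id_Π`; on the model `(Π_k ↷ 𝒪_k̄^⊳)` this is a monoid automorphism
`α` of `𝒪_k̄^⊳` commuting with `G_k`, and `α = id` (`MLFClosure.nonzeroIntegers_mulEquiv_eq_self`):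
(1) `α` acts on the cyclic group `μ_n(k̄) ⊆ 𝒪_k̄^⊳` by `ζ ↦ ζ^{m_n}`; (2) KUMMER: for `yⁿ = x`,
`β := α(y)/y^{m_n}` is `G_{k(x)}`-fixed, so `β ∈ k(x)` (infinite Galois correspondence) and
`α(x) = βⁿ x^{m_n}`; (3) VALUATION: for a uniformizer `ϖ` of `k`, `α(ϖ)` and `α⁻¹(ϖ)` are
`G_k`-fixed non-zero integers of `k` with orders `c, d ≥ 0`, and (2) in `k` gives `c·d ≡ 1 (mod n)`
for every `n`, so `c = d = 1` and `m_n ≡ 1 (mod n)`; (4) hence `α(x)/x ∈ ⋂ₙ (k(x)^×)ⁿ = {1}`, `k(x)`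
being a non-archimedean local field (tree: `FiniteExtension.isNonarchimedeanLocalField`,
`GaloisRepresentations.eq_one_of_forall_exists_pow_eq`).
HONEST FRAMING: OUR kernel check of a classical statement of a refereed paper; it is a pin of the
cell's [IUTchIII] Cor. 3.12 proof-chain bookkeeping (Step (vi)) and takes no side on Cor. 3.12.  The
bijectivity sentence `GaloisIsoLiftsToTMPairIso` (resting on [AbsTopIII] Cor. 1.10) is not touched.
-/

noncomputable section

open scoped Classical

namespace Literature.AnabelianGeometry.AbsoluteAnabelian

open _root_.ValuativeRel IntermediateField
open Literature.NumberTheory.GaloisRepresentations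

universe u

namespace MLFClosure

variable (C : MLFClosure.{u})

/-! ## Preliminaries on the model `(G_k ↷ 𝒪_k̄^⊳)` -/

/-- An `n`-th root of a non-zero integer of `k̄` (e.g. a root of unity) is a non-zero integer.
[cite: MochizukiAbsTopIII2015, Proposition 3.2 (iv) p.72] -/
theorem mem_nonzeroIntegers_of_pow_eq {y : C.K} {n : ℕ} (hn : 0 < n) {x : C.K}
    (hx : x ∈ nonzeroIntegers C.k C.K) (hy : y ^ n = x) : y ∈ nonzeroIntegers C.k C.K := by
  refine ⟨?_, ?_⟩
  · show IsIntegral 𝒪[C.k] y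
    exact IsIntegral.of_pow hn (by rw [hy]; exact hx.1)
  · rintro rfl
    rw [zero_pow hn.ne'] at hy
    exact hx.2 hy.symm

variable {C}

/-- An equivariant monoid automorphism `α` of `𝒪_k̄^⊳` (over the identity of `G_k`): the shape of
the hypothesis used throughout. [cite: MochizukiAbsTopIII2015, Proposition 3.2 (iv) p.72] -/
theorem equivariant_apply_eq_of_fixed
    {α : ↥(nonzeroIntegers C.k C.K) ≃* ↥(nonzeroIntegers C.k C.K)}
    (hα : ∀ (σ : C.K ≃ₐ[C.k] C.K) (x : ↥(nonzeroIntegers C.k C.K)),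
      (α ⟨σ • (x : C.K), smul_mem_nonzeroIntegers σ x.2⟩ : C.K) = σ • (α x : C.K))
    {σ : C.K ≃ₐ[C.k] C.K} {x : ↥(nonzeroIntegers C.k C.K)} (hx : σ (x : C.K) = x) :
    σ (α x : C.K) = α x := by
  have h := hα σ x
  have hsub : (⟨σ • (x : C.K), smul_mem_nonzeroIntegers σ x.2⟩ : ↥(nonzeroIntegers C.k C.K)) = x :=
    Subtype.ext (show σ • (x : C.K) = x by rw [AlgEquiv.smul_def, hx])
  rw [hsub, AlgEquiv.smul_def] at h
  exact h.symm

/-- The inverse of an equivariant automorphism is equivariant. [cite: MochizukiAbsTopIII2015, Proposition 3.2 (iv) p.72] -/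
theorem equivariant_symm
    {α : ↥(nonzeroIntegers C.k C.K) ≃* ↥(nonzeroIntegers C.k C.K)}
    (hα : ∀ (σ : C.K ≃ₐ[C.k] C.K) (x : ↥(nonzeroIntegers C.k C.K)),
      (α ⟨σ • (x : C.K), smul_mem_nonzeroIntegers σ x.2⟩ : C.K) = σ • (α x : C.K))
    (σ : C.K ≃ₐ[C.k] C.K) (x : ↥(nonzeroIntegers C.k C.K)) :
    (α.symm ⟨σ • (x : C.K), smul_mem_nonzeroIntegers σ x.2⟩ : C.K) = σ • (α.symm x : C.K) := by
  have h := hα σ (α.symm x)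
  rw [MulEquiv.apply_symm_apply] at h
  have h' : α ⟨σ • (α.symm x : C.K), smul_mem_nonzeroIntegers σ (α.symm x).2⟩ =
      ⟨σ • (x : C.K), smul_mem_nonzeroIntegers σ x.2⟩ := Subtype.ext h
  have := congrArg α.symm h'
  rw [MulEquiv.symm_apply_apply] at this
  rw [← this]

/-! ## Step 1: roots of unity -/

/-- STEP 1. For `n ≥ 1` there is `m : ℕ` with `α u = u ^ m` for every `u ∈ 𝒪_k̄^⊳` with `uⁿ = 1`
(`α` permutes the cyclic group `μ_n(k̄)`). [cite: MochizukiAbsTopIII2015, Proposition 3.2 (iv) p.72] -/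
theorem exists_pow_eq_on_rootsOfUnity (α : ↥(nonzeroIntegers C.k C.K) ≃* ↥(nonzeroIntegers C.k C.K))
    {n : ℕ} (hn : 0 < n) :
    ∃ m : ℕ, ∀ u : ↥(nonzeroIntegers C.k C.K), (u : C.K) ^ n = 1 → α u = u ^ m := by
  haveI : IsAlgClosed C.K := IsAlgClosure.isAlgClosed C.k
  haveI : CharZero C.K := charZero_of_injective_algebraMap (algebraMap C.k C.K).injective
  haveI : NeZero n := ⟨hn.ne'⟩
  obtain ⟨ζ, hζ⟩ := HasEnoughRootsOfUnity.exists_primitiveRoot C.K n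
  set u₀ : ↥(nonzeroIntegers C.k C.K) :=
    ⟨ζ, C.mem_nonzeroIntegers_of_pow_eq hn (Submonoid.one_mem _) hζ.pow_eq_one⟩ with hu₀
  have hαu₀ : ((α u₀ : ↥(nonzeroIntegers C.k C.K)) : C.K) ^ n = 1 := by
    have h1 : u₀ ^ n = 1 := Subtype.ext (by
      rw [SubmonoidClass.coe_pow, hu₀]; exact hζ.pow_eq_one)
    have h2 : (α u₀) ^ n = 1 := by rw [← map_pow, h1, map_one]
    have h3 := congrArg (fun z : ↥(nonzeroIntegers C.k C.K) => (z : C.K)) h2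
    simpa using h3
  obtain ⟨m, -, hm⟩ := hζ.eq_pow_of_pow_eq_one hαu₀
  refine ⟨m, fun u hu => ?_⟩
  obtain ⟨i, -, hi⟩ := hζ.eq_pow_of_pow_eq_one hu
  have hu' : u = u₀ ^ i := Subtype.ext (by rw [SubmonoidClass.coe_pow, hu₀]; exact hi.symm)
  have hαu₀' : α u₀ = u₀ ^ m := Subtype.ext (by rw [SubmonoidClass.coe_pow, hu₀]; exact hm.symm)
  rw [hu', map_pow, hαu₀', ← pow_mul, ← pow_mul, mul_comm]

/-! ## Step 2: the Kummer relation -/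

/-- STEP 2 (Kummer). Let `α` be equivariant and act on `μ_n` by the `m`-th power.  Then for every
`x ∈ 𝒪_k̄^⊳` there is `β ∈ k̄^×`, fixed by every `τ ∈ G_k` fixing `x`, with `α(x) = βⁿ · x^m`.
[cite: MochizukiAbsTopIII2015, Proposition 3.2 (iv) p.72] -/
theorem exists_kummer_relation
    {α : ↥(nonzeroIntegers C.k C.K) ≃* ↥(nonzeroIntegers C.k C.K)}
    (hα : ∀ (σ : C.K ≃ₐ[C.k] C.K) (x : ↥(nonzeroIntegers C.k C.K)),
      (α ⟨σ • (x : C.K), smul_mem_nonzeroIntegers σ x.2⟩ : C.K) = σ • (α x : C.K))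
    {n m : ℕ} (hn : 0 < n)
    (hm : ∀ u : ↥(nonzeroIntegers C.k C.K), (u : C.K) ^ n = 1 → α u = u ^ m)
    (x : ↥(nonzeroIntegers C.k C.K)) :
    ∃ β : C.K, β ≠ 0 ∧ (∀ τ : C.K ≃ₐ[C.k] C.K, τ (x : C.K) = x → τ β = β) ∧
      (α x : C.K) = β ^ n * (x : C.K) ^ m := by
  haveI : IsAlgClosed C.K := IsAlgClosure.isAlgClosed C.k
  have hx0 : (x : C.K) ≠ 0 := x.2.2
  obtain ⟨y, hy⟩ := IsAlgClosed.exists_pow_nat_eq (x : C.K) hn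
  have hyM : y ∈ nonzeroIntegers C.k C.K := C.mem_nonzeroIntegers_of_pow_eq hn x.2 hy
  have hy0 : y ≠ 0 := hyM.2
  set yM : ↥(nonzeroIntegers C.k C.K) := ⟨y, hyM⟩ with hyMdef
  have hxy : x = yM ^ n := Subtype.ext (by rw [SubmonoidClass.coe_pow, hyMdef]; exact hy.symm)
  set β : C.K := (α yM : C.K) / y ^ m with hβ
  have hαy0 : (α yM : C.K) ≠ 0 := (α yM).2.2
  have hβ0 : β ≠ 0 := div_ne_zero hαy0 (pow_ne_zero _ hy0)
  refine ⟨β, hβ0, fun τ hτ => ?_, ?_⟩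
  · -- `τ y = ζ y` with `ζⁿ = 1`
    set ζ : C.K := τ y / y with hζ
    have hζn : ζ ^ n = 1 := by
      rw [hζ, div_pow, ← map_pow, hy, hτ, div_self hx0]
    have hζM : ζ ∈ nonzeroIntegers C.k C.K :=
      C.mem_nonzeroIntegers_of_pow_eq hn (Submonoid.one_mem _) hζn
    set ζM : ↥(nonzeroIntegers C.k C.K) := ⟨ζ, hζM⟩ with hζMdef
    have hτy : τ y = ζ * y := by rw [hζ, div_mul_cancel₀ _ hy0]
    have h1 := hα τ yM
    have h2 : (⟨τ • (yM : C.K), smul_mem_nonzeroIntegers τ yM.2⟩ : ↥(nonzeroIntegers C.k C.K)) =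
        ζM * yM := Subtype.ext (by
      show τ • y = ζ * y
      rw [AlgEquiv.smul_def, hτy])
    rw [h2, map_mul, hm ζM hζn, AlgEquiv.smul_def] at h1
    have h3 : τ (α yM : C.K) = ζ ^ m * (α yM : C.K) := by
      rw [← h1, Submonoid.coe_mul, SubmonoidClass.coe_pow]
    have hζ0 : ζ ≠ 0 := hζM.2
    rw [hβ, map_div₀, map_pow, h3, hτy, mul_pow]
    exact mul_div_mul_left _ _ (pow_ne_zero _ hζ0)
  · -- `α x = α (y^n) = (α y)^n = (β y^m)^n = β^n x^m`
    have hαy : (α yM : C.K) = β * y ^ m := by rw [hβ, div_mul_cancel₀ _ (pow_ne_zero _ hy0)]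
    rw [hxy, map_pow, SubmonoidClass.coe_pow, hαy, mul_pow, ← pow_mul, SubmonoidClass.coe_pow,
      hyMdef, ← pow_mul, mul_comm m n]

/-! ## Step 3: the valuation of `k` -/

/-- The normalised additive valuation of a non-archimedean local field, packaged as the data used
below: a function `ord : k → ℤ` (the logarithm of Mathlib's `valueGroupWithZeroIsoInt ∘ valuation`),
additive on non-zero elements, `≤ 0` on `𝒪_k ∖ 0`, and `= -1` at a uniformizer `ϖ ∈ 𝒪_k`.
Ref: Serre, *Local Fields*, Ch. II §1. [folklore] -/
private theorem exists_ord (k : Type u) [Field k] [ValuativeRel k] [TopologicalSpace k]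
    [IsNonarchimedeanLocalField k] :
    ∃ (ord : k → ℤ) (ϖ : k), ϖ ≠ 0 ∧ ϖ ∈ 𝒪[k] ∧ ord ϖ = -1 ∧
      (∀ a b : k, a ≠ 0 → b ≠ 0 → ord (a * b) = ord a + ord b) ∧
      (∀ (a : k) (n : ℕ), a ≠ 0 → ord (a ^ n) = n * ord a) ∧
      (∀ a : k, a ≠ 0 → a ∈ 𝒪[k] → ord a ≤ 0) := by
  set e := _root_.IsNonarchimedeanLocalField.valueGroupWithZeroIsoInt k with he
  refine ⟨fun a => WithZero.log (e (valuation k a)), ?_⟩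
  obtain ⟨ϖ, hϖ⟩ := exists_units_isUniformizer (F := k)
  have hne : ∀ a : k, a ≠ 0 → e (valuation k a) ≠ 0 := fun a ha h =>
    ((Valuation.ne_zero_iff _).mpr ha) (e.injective (h.trans (map_zero e).symm))
  refine ⟨(ϖ : k), ϖ.ne_zero, le_of_lt hϖ.val_lt_one, ?_, ?_, ?_, ?_⟩
  · show WithZero.log (e (valuation k (ϖ : k))) = -1
    rw [hϖ.val, IsNonarchimedeanLocalField.valueGroupWithZeroIsoInt_generator, WithZero.log_exp]
  · intro a b ha hb
    show WithZero.log (e (valuation k (a * b))) = WithZero.log (e (valuation k a)) +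
      WithZero.log (e (valuation k b))
    rw [map_mul, map_mul, WithZero.log_mul (hne a ha) (hne b hb)]
  · intro a n ha
    show WithZero.log (e (valuation k (a ^ n))) = n * WithZero.log (e (valuation k a))
    rw [map_pow, map_pow, WithZero.log_pow, nsmul_eq_mul]
  · intro a ha hint
    show WithZero.log (e (valuation k a)) ≤ 0
    rw [WithZero.log_le_iff_le_exp (hne a ha), WithZero.exp_zero, ← map_one e, map_le_map_iff]
    exact hint

/-- An element of `k̄` fixed by every element of `G_k` lies in `k` (infinite Galois theory for the
Galois extension `k̄/k`). [folklore] -/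
private theorem exists_algebraMap_eq_of_fixed {y : C.K} (hfix : ∀ σ : C.K ≃ₐ[C.k] C.K, σ y = y) :
    ∃ a : C.k, algebraMap C.k C.K a = y := by
  have h : y ∈ IntermediateField.fixedField (⊥ : IntermediateField C.k C.K).fixingSubgroup := by
    rw [IntermediateField.fixingSubgroup_bot, IntermediateField.mem_fixedField_iff]
    exact fun σ _ => hfix σ
  rw [InfiniteGalois.fixedField_fixingSubgroup, IntermediateField.mem_bot] at h
  exact h

/-- An element of `k̄` fixed by every `τ ∈ G_k` that fixes `x` lies in `k(x)` (infinite Galois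
correspondence). [folklore] -/
private theorem mem_adjoin_of_fixed {x y : C.K}
    (h : ∀ τ : C.K ≃ₐ[C.k] C.K, τ x = x → τ y = y) :
    y ∈ IntermediateField.adjoin C.k ({x} : Set C.K) := by
  rw [← InfiniteGalois.fixedField_fixingSubgroup (IntermediateField.adjoin C.k ({x} : Set C.K)),
    IntermediateField.mem_fixedField_iff]
  intro τ hτ
  exact h τ ((IntermediateField.mem_fixingSubgroup_iff _ _).mp hτ x
    (IntermediateField.mem_adjoin_simple_self C.k x))

/-- STEP 3 (the exponents are `≡ 1 mod n`).  Let `α` be an equivariant automorphism of `𝒪_k̄^⊳` and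
`ϖ ∈ k` a uniformizer.  Then for every `n ≥ 1`, with `α = (·)^m` on `μ_n(k̄)`, the Kummer relation
for `ϖ` reads `α(ϖ) = βⁿ ϖ^m` with `β ∈ k` and `(m : ℤ) = n·ord β + 1` — because `α(ϖ)` and
`α⁻¹(ϖ)` are `G_k`-fixed integers whose orders `c, d ≥ 0` satisfy `c·d ≡ 1 (mod n)` for all `n`,
hence `c = d = 1`. [cite: MochizukiAbsTopIII2015, Proposition 3.2 (iv) p.72] -/
theorem exists_exponent_congr_one
    {α : ↥(nonzeroIntegers C.k C.K) ≃* ↥(nonzeroIntegers C.k C.K)}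
    (hα : ∀ (σ : C.K ≃ₐ[C.k] C.K) (x : ↥(nonzeroIntegers C.k C.K)),
      (α ⟨σ • (x : C.K), smul_mem_nonzeroIntegers σ x.2⟩ : C.K) = σ • (α x : C.K))
    {n : ℕ} (hn : 0 < n) :
    ∃ (m : ℕ) (t : ℤ), (∀ u : ↥(nonzeroIntegers C.k C.K), (u : C.K) ^ n = 1 → α u = u ^ m) ∧
      (m : ℤ) = n * t + 1 := by
  obtain ⟨ord, ϖ, hϖ0, hϖint, hordϖ, hmul, hpow, hint⟩ := exists_ord C.k
  have hinj := (algebraMap C.k C.K).injective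
  set ϖK : C.K := algebraMap C.k C.K ϖ with hϖK
  have hϖKM : ϖK ∈ nonzeroIntegers C.k C.K :=
    ⟨(isIntegral_algebraMap_iff_mem_integer C.k C.K).mpr hϖint,
      (map_ne_zero_iff _ hinj).mpr hϖ0⟩
  set P : ↥(nonzeroIntegers C.k C.K) := ⟨ϖK, hϖKM⟩ with hP
  have hPfix : ∀ σ : C.K ≃ₐ[C.k] C.K, σ ϖK = ϖK := fun σ => σ.commutes ϖ
  set Q : ↥(nonzeroIntegers C.k C.K) := α.symm P with hQ
  have hQfix : ∀ σ : C.K ≃ₐ[C.k] C.K, σ (Q : C.K) = Q := by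
    intro σ
    have h := equivariant_symm hα σ P
    have hsub : (⟨σ • (P : C.K), smul_mem_nonzeroIntegers σ P.2⟩ : ↥(nonzeroIntegers C.k C.K)) = P :=
      Subtype.ext (show σ • ϖK = ϖK by rw [AlgEquiv.smul_def, hPfix])
    rw [hsub, AlgEquiv.smul_def] at h
    exact h.symm
  obtain ⟨q₀, hq₀⟩ := exists_algebraMap_eq_of_fixed hQfix
  have hq₀0 : q₀ ≠ 0 := fun h0 => Q.2.2 (by rw [← hq₀, h0, map_zero])
  have hq₀int : q₀ ∈ 𝒪[C.k] :=
    (isIntegral_algebraMap_iff_mem_integer C.k C.K).mp (by rw [hq₀]; exact Q.2.1)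
  have hafix : ∀ σ : C.K ≃ₐ[C.k] C.K, σ (α P : C.K) = α P :=
    fun σ => equivariant_apply_eq_of_fixed hα (hPfix σ)
  obtain ⟨a₀, ha₀⟩ := exists_algebraMap_eq_of_fixed hafix
  have ha₀0 : a₀ ≠ 0 := fun h0 => (α P).2.2 (by rw [← ha₀, h0, map_zero])
  have ha₀int : a₀ ∈ 𝒪[C.k] :=
    (isIntegral_algebraMap_iff_mem_integer C.k C.K).mp (by rw [ha₀]; exact (α P).2.1)
  have key : ∀ N : ℕ, 0 < N → ∃ (m : ℕ) (t : ℤ),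
      (∀ u : ↥(nonzeroIntegers C.k C.K), (u : C.K) ^ N = 1 → α u = u ^ m) ∧
      (m : ℤ) = N * t - ord a₀ ∧ (N : ℤ) ∣ ord a₀ * ord q₀ - 1 := by
    intro N hN
    obtain ⟨m, hm⟩ := exists_pow_eq_on_rootsOfUnity α hN
    -- Kummer for `ϖ`
    obtain ⟨β₁, hβ₁0, hβ₁fix, hβ₁⟩ := exists_kummer_relation hα hN hm P
    obtain ⟨b₁, hb₁⟩ := exists_algebraMap_eq_of_fixed (fun σ => hβ₁fix σ (hPfix σ))
    have hb₁0 : b₁ ≠ 0 := fun h0 => hβ₁0 (by rw [← hb₁, h0, map_zero])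
    have hrel₁ : a₀ = b₁ ^ N * ϖ ^ m := hinj (by
      rw [ha₀, map_mul, map_pow, map_pow, hb₁]; exact hβ₁)
    have hord₁ : ord a₀ = N * ord b₁ + m * ord ϖ := by
      rw [hrel₁, hmul _ _ (pow_ne_zero _ hb₁0) (pow_ne_zero _ hϖ0), hpow _ _ hb₁0, hpow _ _ hϖ0]
    -- Kummer for `Q = α⁻¹ ϖ`
    obtain ⟨β₂, hβ₂0, hβ₂fix, hβ₂⟩ := exists_kummer_relation hα hN hm Q
    obtain ⟨b₂, hb₂⟩ := exists_algebraMap_eq_of_fixed (fun σ => hβ₂fix σ (hQfix σ))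
    have hb₂0 : b₂ ≠ 0 := fun h0 => hβ₂0 (by rw [← hb₂, h0, map_zero])
    have hαQ : (α Q : C.K) = ϖK := by rw [hQ, MulEquiv.apply_symm_apply]
    have hrel₂ : ϖ = b₂ ^ N * q₀ ^ m := hinj (by
      rw [map_mul, map_pow, map_pow, hb₂, hq₀, ← hϖK, ← hαQ]; exact hβ₂)
    have hord₂ : ord ϖ = N * ord b₂ + m * ord q₀ := by
      rw [hrel₂, hmul _ _ (pow_ne_zero _ hb₂0) (pow_ne_zero _ hq₀0), hpow _ _ hb₂0, hpow _ _ hq₀0]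
    rw [hordϖ] at hord₁ hord₂
    refine ⟨m, ord b₁, hm, by linarith, ⟨ord b₂ + ord q₀ * ord b₁, ?_⟩⟩
    linear_combination (ord q₀) * hord₁ + hord₂
  have hcd : ord a₀ * ord q₀ - 1 = 0 := by
    obtain ⟨-, -, -, -, hdvd⟩ := key ((ord a₀ * ord q₀ - 1).natAbs + 1) (Nat.succ_pos _)
    exact Int.eq_zero_of_dvd_of_natAbs_lt_natAbs hdvd
      (by rw [Int.natAbs_natCast]; exact Nat.lt_succ_self _)
  have hc : ord a₀ = -1 := by
    have ha := hint a₀ ha₀0 ha₀int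
    have hq := hint q₀ hq₀0 hq₀int
    have h1 : (-ord a₀) * (-ord q₀) = 1 := by linarith
    have := Int.eq_one_of_mul_eq_one_right (by linarith) h1
    linarith
  obtain ⟨m, t, hm, hmt, -⟩ := key n hn
  exact ⟨m, t, hm, by rw [hmt, hc]; ring⟩

/-! ## Step 4: conclusion -/

/-- **An equivariant monoid automorphism of `𝒪_k̄^⊳` over the identity of `G_k` is the identity**
(the model case of [AbsTopIII] Prop. 3.2 (iv), injectivity, for `T = TM`).
[cite: MochizukiAbsTopIII2015, Proposition 3.2 (iv) p.72] -/
theorem nonzeroIntegers_mulEquiv_eq_self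
    (α : ↥(nonzeroIntegers C.k C.K) ≃* ↥(nonzeroIntegers C.k C.K))
    (hα : ∀ (σ : C.K ≃ₐ[C.k] C.K) (x : ↥(nonzeroIntegers C.k C.K)),
      (α ⟨σ • (x : C.K), smul_mem_nonzeroIntegers σ x.2⟩ : C.K) = σ • (α x : C.K))
    (x : ↥(nonzeroIntegers C.k C.K)) : α x = x := by
  have hx0 : (x : C.K) ≠ 0 := x.2.2
  set E : IntermediateField C.k C.K := IntermediateField.adjoin C.k ({(x : C.K)} : Set C.K) with hE
  have hxk : IsIntegral C.k (x : C.K) := (Algebra.IsAlgebraic.isAlgebraic (x : C.K)).isIntegral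
  haveI : FiniteDimensional C.k E := IntermediateField.adjoin.finiteDimensional hxk
  letI := FiniteExtension.valuativeRel C.k E
  letI := FiniteExtension.topologicalSpace C.k E
  haveI := FiniteExtension.isNonarchimedeanLocalField C.k E
  have hxE : (x : C.K) ∈ E := IntermediateField.mem_adjoin_simple_self C.k (x : C.K)
  have hαxE : (α x : C.K) ∈ E :=
    mem_adjoin_of_fixed (fun τ hτ => equivariant_apply_eq_of_fixed hα hτ)
  set q : C.K := (α x : C.K) / x with hq
  have hq0 : q ≠ 0 := div_ne_zero (α x).2.2 hx0
  have hqE : q ∈ E := div_mem hαxE hxE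
  -- `q` has `n`-th roots in `E` for every `n`
  have hroots : ∀ n : ℕ, 0 < n → ∃ γ : C.K, γ ∈ E ∧ γ ^ n = q := by
    intro n hn
    obtain ⟨m, t, hm, hmt⟩ := exists_exponent_congr_one hα hn
    obtain ⟨β, hβ0, hβfix, hβ⟩ := exists_kummer_relation hα hn hm x
    have hβE : β ∈ E := mem_adjoin_of_fixed hβfix
    refine ⟨β * (x : C.K) ^ t, mul_mem hβE (zpow_mem hxE t), ?_⟩
    have hxm : (x : C.K) ^ m = ((x : C.K) ^ t) ^ n * x := by
      rw [← zpow_natCast (x : C.K) m, hmt, zpow_add₀ hx0, zpow_one, mul_comm (n : ℤ) t, zpow_mul,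
        zpow_natCast]
    rw [hq, hβ, hxm, mul_pow]
    field_simp
  -- in the local field `E`, `⋂ₙ (E^×)ⁿ = 1`
  set qE : E := ⟨q, hqE⟩ with hqEdef
  have hqE0 : qE ≠ 0 := fun h => hq0 (congrArg (fun z : E => (z : C.K)) h)
  have hone : Units.mk0 qE hqE0 = 1 := by
    refine eq_one_of_forall_exists_pow_eq E (Units.mk0 qE hqE0) fun n hn => ?_
    obtain ⟨γ, hγE, hγ⟩ := hroots n hn
    have hγn : (⟨γ, hγE⟩ : E) ^ n = qE := Subtype.ext (by
      rw [SubmonoidClass.coe_pow]; exact hγ)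
    have hγ0 : (⟨γ, hγE⟩ : E) ≠ 0 := by
      intro h0
      rw [h0, zero_pow hn.ne'] at hγn
      exact hqE0 hγn.symm
    exact ⟨Units.mk0 _ hγ0, Units.ext (by simpa using hγn)⟩
  have hq1 : q = 1 := by
    have h := congrArg (fun u : Eˣ => ((u : E) : C.K)) hone
    simpa [hqEdef] using h
  apply Subtype.ext
  have : (α x : C.K) = q * x := by rw [hq, div_mul_cancel₀ _ hx0]
  rw [this, hq1, one_mul]

end MLFClosure

/-! ## Proposition 3.2 (iv), injectivity: the named fact -/

/-- In an isomorphism of pairs, the monoid component intertwines the INVERSE too. [folklore] -/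
private theorem GaloisMonoidPair.Iso.symm_smul {P Q : GaloisMonoidPair.{u}} (e : GaloisMonoidPair.Iso P Q)
    (g : P.Pi) (y : Q.M) : e.isoM.symm (e.isoPi g • y) = g • e.isoM.symm y := by
  apply e.isoM.injective
  rw [MulEquiv.apply_symm_apply, e.smul_comm, MulEquiv.apply_symm_apply]

/-- **[AbsTopIII] Prop. 3.2 (iv), injectivity half, DISCHARGED**: abc-iut-L4-t2's named fact
`PairIsoDeterminedByGalois` — "the natural functor of Definition 3.1, (iii), induces an injection
`Isom((Π ↷ M_T), (Π* ↷ M*_T)) ↪ Isom_TG(Π, Π*)`" for MLF-Galois `TM`-pairs: two isomorphisms of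
`TM`-pairs with the same Galois component coincide.  PROOF: reduce to an automorphism of one pair
over `id_Π`, transport to the model `(Π_k ↷ 𝒪_k̄^⊳)`, and apply
`MLFClosure.nonzeroIntegers_mulEquiv_eq_self` (Kummer theory + `⋂ₙ (k(x)^×)ⁿ = 1`; no class field
theory). [cite: MochizukiAbsTopIII2015, Proposition 3.2 (iv) p.72] -/
theorem pairIsoDeterminedByGalois_holds : PairIsoDeterminedByGalois := by
  intro P Q hP _ e₁ e₂ hPi
  obtain ⟨C, D, Q₀, hQ₀, ⟨ψ⟩⟩ := hP.exists_model
  simp only [ModelMLFGaloisData.monoidPair, Option.some.injEq] at hQ₀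
  subst hQ₀
  set α : ↥(nonzeroIntegers C.k C.K) ≃* ↥(nonzeroIntegers C.k C.K) :=
    ψ.isoM.trans (e₁.isoM.trans (e₂.isoM.symm.trans ψ.isoM.symm)) with hαdef
  have hαapp : ∀ z, α z = ψ.isoM.symm (e₂.isoM.symm (e₁.isoM (ψ.isoM z))) := fun z => rfl
  have hα : ∀ (σ : C.K ≃ₐ[C.k] C.K) (z : ↥(nonzeroIntegers C.k C.K)),
      (α ⟨σ • (z : C.K), smul_mem_nonzeroIntegers σ z.2⟩ : C.K) = σ • (α z : C.K) := by
    intro σ z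
    obtain ⟨g, rfl⟩ := D.aug_surjective σ
    have h1 : ψ.isoM ⟨D.aug g • (z : C.K), smul_mem_nonzeroIntegers (D.aug g) z.2⟩ =
        ψ.isoPi g • ψ.isoM z := ψ.smul_comm g z
    have h2 : ψ.isoM ⟨D.aug g • (α z : C.K), smul_mem_nonzeroIntegers (D.aug g) (α z).2⟩ =
        ψ.isoPi g • ψ.isoM (α z) := ψ.smul_comm g (α z)
    suffices hs : α ⟨D.aug g • (z : C.K), smul_mem_nonzeroIntegers (D.aug g) z.2⟩ =
        ⟨D.aug g • (α z : C.K), smul_mem_nonzeroIntegers (D.aug g) (α z).2⟩ from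
      congrArg Subtype.val hs
    apply ψ.isoM.injective
    rw [h2, hαapp, hαapp, MulEquiv.apply_symm_apply, MulEquiv.apply_symm_apply, h1, e₁.smul_comm,
      hPi, e₂.symm_smul]
  apply MulEquiv.ext
  intro y
  have h := MLFClosure.nonzeroIntegers_mulEquiv_eq_self α hα (ψ.isoM.symm y)
  rw [hαapp, MulEquiv.apply_symm_apply] at h
  have h2 : e₂.isoM.symm (e₁.isoM y) = y := ψ.isoM.symm.injective h
  calc e₁.isoM y = e₂.isoM (e₂.isoM.symm (e₁.isoM y)) := (e₂.isoM.apply_symm_apply _).symm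
    _ = e₂.isoM y := by rw [h2]

end Literature.AnabelianGeometry.AbsoluteAnabelian

end
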